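import Summits.NavierStokesRegularity.FunctionalMining.NoGo.SpiralJetKillAll
import HarnessLib

/-!
# K1-Q2 below `q = 2`, part 1: `∫ (|ω|²)^r σ < 0` on the spiral jet for every `r ∈ [−1/2, 0)`

Search for candidate a priori estimates; no regularity claim. NS FUNCTIONAL MINING — NO-GO BRANCH
(cell `pub-nsfunc`, prove seat gen 14). The spiral-jet witness `sfld` (`NoGo/SpiralJet*`, gen 13) has
`λ₂(S) ≡ 0` and `∫_{T³}(|ω|²)^rσ > 0` for every real `r > 0` (`integral_moment_pos`), which kills the
K0 rows `E.q|T_C|C3b` for `q = 2r + 2 > 2`. For the row `E.q=3/2|T_C|C3b` one needs `r = −1/4`: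
here we prove **`∫_{T³}(|ω|²)^rσ(sfld) < 0` for every `r ∈ [−1/2, 0)`** (`integral_moment_neg`). The
symmetrisation of part 4 is unchanged (`2∫(|ω|²)^rσ = ∫(Gcoll + Dplat)∘repr`, `∫Gcoll∘repr = 0` by the
`x`-reflection); what changes is

* the SIGN: for `r ≤ 0`, `t ↦ t^r` is antitone on `(0, ∞)`, so the bracket
  `(A0+X2+2X1)^r − (A0+X2−2X1)^r` has the sign OPPOSITE to `X1` wherever `V = Vz(y₂) > 0` (both
  bases are `≥ 4V² > 0`), and the plateau density `Dplat = bracket·8V s ψf′ X1` is `≤ 0` everywhere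
  (where `V = 0` it vanishes through the factor `V`);
* the BOOKKEEPING: for `r < 0` the powers `(A0+X2±2X1)^r` are unbounded near the zeros of the bases
  (Lean's `0 ^ r = 0`, but `t ^ r → ∞` as `t → 0⁺`), so the densities are no longer continuous; they
  stay BOUNDED because every density carries a factor `V` and the bases are `≥ 4V²`:
  `|b^r · V| ≤ 2` for `b ≥ 4V²`, `0 ≤ V ≤ 2`, `−1/2 ≤ r ≤ 0` (`abs_rpow_mul_le_two`). Integrability on
  the cube / torus then follows by domination by a continuous function, and the strict sign from
  continuity of `Dplat` AT the interior point of part 4 (both bases `≥ 4` there).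

Static facts about one explicit field; nothing about Navier–Stokes is asserted.
-/

noncomputable section

open MeasureTheory Set Function Filter Topology Metric
open scoped ContDiff Real

namespace Summit.NavierStokesRegularity.FunctionalMining

namespace SpiralJet

open Literature.Analysis.FunctionSpaces Literature.Analysis.FunctionSpaces.Torus
  Literature.Analysis.FluidPDE KillAll VorticityL4

/-! ## 1. Signs for `r ≤ 0` -/

/-- `Vz ≤ 2`. [folklore] -/
theorem Vz_le_two (t : ℝ) : Vz t ≤ 2 := by
  unfold Vz; linarith [Real.neg_one_le_cos (2 * π * t)]

/-- Both bases dominate `4V²`. [ours] -/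
theorem four_Vz_sq_le_bases (y : E3) :
    4 * Vz (y 2) ^ 2 ≤ A0 y + X2 y + 2 * X1 y ∧ 4 * Vz (y 2) ^ 2 ≤ A0 y + X2 y - 2 * X1 y := by
  rw [A0_add_X2_add, A0_add_X2_sub]
  constructor <;> nlinarith [sq_nonneg (J2x y + qc y * dVz (y 2)), sq_nonneg (J2y y - pc y * dVz (y 2)),
    sq_nonneg (J2x y - qc y * dVz (y 2)), sq_nonneg (J2y y + pc y * dVz (y 2))]

/-- **For `r ≤ 0` the bracket has the sign OPPOSITE to `X1` wherever `V ≠ 0`** (both bases are then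
`> 0` and `t ↦ t^r` is antitone on `(0, ∞)`). [ours] -/
theorem bracket_mul_X1_nonpos {r : ℝ} (hr : r ≤ 0) (y : E3) (hV : Vz (y 2) ≠ 0) :
    bracket r y * X1 y ≤ 0 := by
  obtain ⟨hp, hm⟩ := four_Vz_sq_le_bases y
  have hV2 : 0 < 4 * Vz (y 2) ^ 2 := by positivity
  have hp0 : 0 < A0 y + X2 y + 2 * X1 y := lt_of_lt_of_le hV2 hp
  have hm0 : 0 < A0 y + X2 y - 2 * X1 y := lt_of_lt_of_le hV2 hm
  unfold bracket
  rcases le_or_gt 0 (X1 y) with hx | hx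
  · have hle : A0 y + X2 y - 2 * X1 y ≤ A0 y + X2 y + 2 * X1 y := by linarith
    have h := Real.rpow_le_rpow_of_nonpos hm0 hle hr
    exact mul_nonpos_of_nonpos_of_nonneg (by linarith) hx
  · have hle : A0 y + X2 y + 2 * X1 y ≤ A0 y + X2 y - 2 * X1 y := by linarith
    have h := Real.rpow_le_rpow_of_nonpos hp0 hle hr
    exact mul_nonpos_of_nonneg_of_nonpos (by linarith) hx.le

/-- **`Dplat ≤ 0` everywhere for `r ≤ 0`.** [ours] -/
theorem Dplat_nonpos {r : ℝ} (hr : r ≤ 0) (y : E3) : Dplat r y ≤ 0 := by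
  have e : Dplat r y = (bracket r y * X1 y) * (8 * Vz (y 2) * rs y * deriv ψf (rs y)) := by
    unfold Dplat; ring
  rw [e]
  by_cases hV : Vz (y 2) = 0
  · rw [hV]; simp
  · exact mul_nonpos_of_nonpos_of_nonneg (bracket_mul_X1_nonpos hr y hV)
      (mul_nonneg (mul_nonneg (mul_nonneg (by norm_num) (Vz_nonneg _)) (rs_nonneg y)) (deriv_ψf_nonneg _))

/-! ## 2. Uniform bounds for `−1/2 ≤ r ≤ 0` -/

/-- **`|b^r · V| ≤ 2`** for `b ≥ 4V²`, `0 ≤ V ≤ 2`, `−1/2 ≤ r ≤ 0`: if `V = 0` the product vanishes;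
otherwise `b^r ≤ (4V²)^r = (2V)^{2r}` and `(2V)^{2r}·V = ½(2V)^{2r+1} ≤ ½·max(1, 2V) ≤ 2`. [ours] -/
theorem abs_rpow_mul_le_two {r b V : ℝ} (hr1 : -1 / 2 ≤ r) (hr0 : r ≤ 0) (hV0 : 0 ≤ V) (hV2 : V ≤ 2)
    (hb : 4 * V ^ 2 ≤ b) : |b ^ r * V| ≤ 2 := by
  rcases hV0.eq_or_lt with hV | hV
  · rw [← hV]; simp
  · have h4 : 0 < 4 * V ^ 2 := by positivity
    have hb0 : 0 < b := lt_of_lt_of_le h4 hb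
    have hbr : b ^ r ≤ (4 * V ^ 2) ^ r := Real.rpow_le_rpow_of_nonpos h4 hb hr0
    have hbr0 : 0 ≤ b ^ r := Real.rpow_nonneg hb0.le r
    rw [abs_of_nonneg (mul_nonneg hbr0 hV0)]
    have e1 : (4 * V ^ 2) ^ r * V = 2⁻¹ * (2 * V) ^ (2 * r + 1) := by
      rw [show (4 : ℝ) * V ^ 2 = (2 * V) ^ (2 : ℕ) by ring, ← Real.rpow_natCast,
        ← Real.rpow_mul (by positivity), Real.rpow_add (by positivity), Real.rpow_one]
      push_cast
      ring
    have e2 : (2 * V) ^ (2 * r + 1) ≤ 4 := by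
      rcases le_or_gt (2 * V) 1 with h1 | h1
      · exact (Real.rpow_le_one (by positivity) h1 (by linarith)).trans (by norm_num)
      · calc (2 * V) ^ (2 * r + 1) ≤ (2 * V) ^ (1 : ℝ) :=
              Real.rpow_le_rpow_of_exponent_le h1.le (by linarith)
          _ ≤ 4 := by rw [Real.rpow_one]; linarith
    calc b ^ r * V ≤ (4 * V ^ 2) ^ r * V := mul_le_mul_of_nonneg_right hbr hV0
      _ = 2⁻¹ * (2 * V) ^ (2 * r + 1) := e1
      _ ≤ 2 := by linarith

/-- **`|Dplat| ≤ 4 · (8 s ψf′(s) |X1|)`** for `−1/2 ≤ r ≤ 0` (a continuous majorant). [ours] -/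
theorem abs_Dplat_le {r : ℝ} (hr1 : -1 / 2 ≤ r) (hr0 : r ≤ 0) (y : E3) :
    |Dplat r y| ≤ 4 * (8 * rs y * deriv ψf (rs y) * |X1 y|) := by
  obtain ⟨hp, hm⟩ := four_Vz_sq_le_bases y
  have h1 := abs_rpow_mul_le_two hr1 hr0 (Vz_nonneg (y 2)) (Vz_le_two (y 2)) hp
  have h2 := abs_rpow_mul_le_two hr1 hr0 (Vz_nonneg (y 2)) (Vz_le_two (y 2)) hm
  have hc : 0 ≤ 8 * rs y * deriv ψf (rs y) :=
    mul_nonneg (mul_nonneg (by norm_num) (rs_nonneg y)) (deriv_ψf_nonneg _)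
  have e : Dplat r y = ((A0 y + X2 y + 2 * X1 y) ^ r * Vz (y 2) - (A0 y + X2 y - 2 * X1 y) ^ r * Vz (y 2)) *
      ((8 * rs y * deriv ψf (rs y)) * X1 y) := by
    unfold Dplat bracket; ring
  rw [e, abs_mul, abs_mul, abs_of_nonneg hc]
  have h3 : |(A0 y + X2 y + 2 * X1 y) ^ r * Vz (y 2) - (A0 y + X2 y - 2 * X1 y) ^ r * Vz (y 2)| ≤ 4 :=
    (abs_sub _ _).trans (by linarith)
  calc _ ≤ 4 * (8 * rs y * deriv ψf (rs y) * |X1 y|) :=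
        mul_le_mul_of_nonneg_right h3 (mul_nonneg hc (abs_nonneg _))

/-- **`|Gcoll| ≤ 4 · (4 |V′| |(kf + 2s kf′)(p cf − q df)|)`** for `−1/2 ≤ r ≤ 0`. [ours] -/
theorem abs_Gcoll_le {r : ℝ} (hr1 : -1 / 2 ≤ r) (hr0 : r ≤ 0) (y : E3) :
    |Gcoll r y| ≤ 4 * (4 * |dVz (y 2)| *
      |(kf (rs y) + 2 * rs y * deriv kf (rs y)) * (pc y * cf (rs y) - qc y * df (rs y))|) := by
  obtain ⟨hp, hm⟩ := four_Vz_sq_le_bases y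
  have h1 := abs_rpow_mul_le_two hr1 hr0 (Vz_nonneg (y 2)) (Vz_le_two (y 2)) hp
  have h2 := abs_rpow_mul_le_two hr1 hr0 (Vz_nonneg (y 2)) (Vz_le_two (y 2)) hm
  have e : Gcoll r y = ((A0 y + X2 y + 2 * X1 y) ^ r * Vz (y 2) - (A0 y + X2 y - 2 * X1 y) ^ r * Vz (y 2)) *
      (-4 * dVz (y 2) * ((kf (rs y) + 2 * rs y * deriv kf (rs y)) * (pc y * cf (rs y) - qc y * df (rs y)))) := by
    unfold Gcoll bracket Scoll; ring
  rw [e, abs_mul]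
  have h3 : |(A0 y + X2 y + 2 * X1 y) ^ r * Vz (y 2) - (A0 y + X2 y - 2 * X1 y) ^ r * Vz (y 2)| ≤ 4 :=
    (abs_sub _ _).trans (by linarith)
  have h4 : |(-4 * dVz (y 2) * ((kf (rs y) + 2 * rs y * deriv kf (rs y)) *
      (pc y * cf (rs y) - qc y * df (rs y))))| = 4 * |dVz (y 2)| *
      |(kf (rs y) + 2 * rs y * deriv kf (rs y)) * (pc y * cf (rs y) - qc y * df (rs y))| := by
    rw [abs_mul, abs_mul]; norm_num
  rw [h4]
  exact mul_le_mul_of_nonneg_right h3 (by positivity)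

/-- **`|(A0 + 2X1 + X2)^r S1| ≤ 2 · (4|V′| |p J2x + q J2y|)`** and the same for the reflected density
`(A0 + X2 − 2X1)^r (−S1)`, for `−1/2 ≤ r ≤ 0`. [ours] -/
theorem abs_moment_density_le {r : ℝ} (hr1 : -1 / 2 ≤ r) (hr0 : r ≤ 0) (y : E3) :
    |(A0 y + 2 * X1 y + X2 y) ^ r * S1 y| ≤ 2 * (4 * |dVz (y 2)| * |pc y * J2x y + qc y * J2y y|) ∧
    |(A0 y + X2 y - 2 * X1 y) ^ r * (-S1 y)| ≤ 2 * (4 * |dVz (y 2)| * |pc y * J2x y + qc y * J2y y|) := by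
  obtain ⟨hp, hm⟩ := four_Vz_sq_le_bases y
  rw [show A0 y + X2 y + 2 * X1 y = A0 y + 2 * X1 y + X2 y by ring] at hp
  have h1 := abs_rpow_mul_le_two hr1 hr0 (Vz_nonneg (y 2)) (Vz_le_two (y 2)) hp
  have h2 := abs_rpow_mul_le_two hr1 hr0 (Vz_nonneg (y 2)) (Vz_le_two (y 2)) hm
  have hS : ∀ c : ℝ, c * S1 y = (c * Vz (y 2)) * (-4 * dVz (y 2) * (pc y * J2x y + qc y * J2y y)) := by
    intro c; unfold S1; ring
  have hS' : ∀ c : ℝ, c * (-S1 y) = (c * Vz (y 2)) * (4 * dVz (y 2) * (pc y * J2x y + qc y * J2y y)) := by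
    intro c; unfold S1; ring
  have h4 : |(-4 * dVz (y 2) * (pc y * J2x y + qc y * J2y y))| = 4 * |dVz (y 2)| * |pc y * J2x y + qc y * J2y y| := by
    rw [abs_mul, abs_mul]; norm_num
  have h4' : |(4 * dVz (y 2) * (pc y * J2x y + qc y * J2y y))| = 4 * |dVz (y 2)| * |pc y * J2x y + qc y * J2y y| := by
    rw [abs_mul, abs_mul]; norm_num
  constructor
  · rw [hS, abs_mul, h4]
    exact mul_le_mul_of_nonneg_right h1 (by positivity)
  · rw [hS', abs_mul, h4']
    exact mul_le_mul_of_nonneg_right h2 (by positivity)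

/-! ## 3. Measurability and integrability of the densities (`−1/2 ≤ r ≤ 0`) -/

/-- `Dplat r` and `Gcoll r` are measurable on `ℝ³` (every real `r`). [ours, bookkeeping] -/
theorem measurable_Dplat_Gcoll (r : ℝ) : Measurable (Dplat r) ∧ Measurable (Gcoll r) := by
  obtain ⟨hA, hX1, hX2, -, hS⟩ := continuous_densities
  have hrs := contDiff_rs.continuous
  have hV : Continuous fun y : E3 => Vz (y 2) :=
    continuous_Vz.comp ((EuclideanSpace.proj (2 : Fin 3) : E3 →L[ℝ] ℝ).continuous)
  have hψ' : Continuous fun y => deriv ψf (rs y) := (contDiff_ψf.continuous_deriv (by simp)).comp hrs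
  have hb : Measurable (bracket r) := by
    unfold bracket
    exact (((hA.add hX2).add (continuous_const.mul hX1)).measurable.pow_const r).sub
      (((hA.add hX2).sub (continuous_const.mul hX1)).measurable.pow_const r)
  constructor
  · unfold Dplat
    exact hb.mul ((((continuous_const.mul hV).mul hrs).mul hψ').mul hX1).measurable
  · unfold Gcoll
    exact hb.mul hS.measurable

/-- **`Dplat r` and `Gcoll r` are integrable on the unit cube** for `−1/2 ≤ r ≤ 0` (bounded by
continuous majorants). [ours, bookkeeping] -/
theorem integrableOn_Dplat_Gcoll {r : ℝ} (hr1 : -1 / 2 ≤ r) (hr0 : r ≤ 0) :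
    IntegrableOn (Dplat r) (unitCube (Fin 3)) volume ∧ IntegrableOn (Gcoll r) (unitCube (Fin 3)) volume := by
  obtain ⟨hD, hG⟩ := measurable_Dplat_Gcoll r
  obtain ⟨-, hX1, -, -, -⟩ := continuous_densities
  have hrs := contDiff_rs.continuous
  have hpc := contDiff_pc.continuous
  have hqc := contDiff_qc.continuous
  have hdV : Continuous fun y : E3 => dVz (y 2) :=
    continuous_dVz.comp ((EuclideanSpace.proj (2 : Fin 3) : E3 →L[ℝ] ℝ).continuous)
  have hψ' : Continuous fun y => deriv ψf (rs y) := (contDiff_ψf.continuous_deriv (by simp)).comp hrs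
  have hk : Continuous fun y => kf (rs y) := contDiff_kf.continuous.comp hrs
  have hk' : Continuous fun y => deriv kf (rs y) := (contDiff_kf.continuous_deriv (by simp)).comp hrs
  have hc : Continuous fun y => cf (rs y) := contDiff_cf.continuous.comp hrs
  have hd : Continuous fun y => df (rs y) := contDiff_df.continuous.comp hrs
  constructor
  · have hmaj : Continuous fun y => 4 * (8 * rs y * deriv ψf (rs y) * |X1 y|) := by fun_prop
    refine Integrable.mono' (integrableOn_unitCube hmaj) hD.aestronglyMeasurable
      (ae_of_all _ fun y => ?_)
    rw [Real.norm_eq_abs]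
    exact abs_Dplat_le hr1 hr0 y
  · have hmaj : Continuous fun y => 4 * (4 * |dVz (y 2)| *
        |(kf (rs y) + 2 * rs y * deriv kf (rs y)) * (pc y * cf (rs y) - qc y * df (rs y))|) := by
      fun_prop
    refine Integrable.mono' (integrableOn_unitCube hmaj) hG.aestronglyMeasurable
      (ae_of_all _ fun y => ?_)
    rw [Real.norm_eq_abs]
    exact abs_Gcoll_le hr1 hr0 y

/-- **The weighted stretching density `(|ω|²)^r σ` of the spiral jet is integrable on `T³`** for
`−1/2 ≤ r ≤ 0` (bounded by a continuous majorant of the cube representative). [ours, bookkeeping] -/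
theorem integrable_moment_density {r : ℝ} (hr1 : -1 / 2 ≤ r) (hr0 : r ≤ 0) :
    Integrable (fun ξ : UnitAddTorus (Fin 3) =>
      torusVorticitySqAt sfld ξ ^ r * torusStretchingDensity sfld ξ) := by
  obtain ⟨hx, hy⟩ := continuous_J2xy
  have hpc := contDiff_pc.continuous
  have hqc := contDiff_qc.continuous
  have hdV : Continuous fun y : E3 => dVz (y 2) :=
    continuous_dVz.comp ((EuclideanSpace.proj (2 : Fin 3) : E3 →L[ℝ] ℝ).continuous)
  have hmaj : Continuous fun y : E3 => 2 * (4 * |dVz (y 2)| * |pc y * J2x y + qc y * J2y y|) := by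
    fun_prop
  have hmi : Integrable (fun ξ : UnitAddTorus (Fin 3) =>
      2 * (4 * |dVz (repr ξ 2)| * |pc (repr ξ) * J2x (repr ξ) + qc (repr ξ) * J2y (repr ξ)|)) :=
    integrable_comp_repr (integrableOn_unitCube hmaj)
  have hQ : Continuous (torusVorticitySqAt sfld) := continuous_vorticitySqAt isSmooth_sfld
  have hσ : Continuous (torusStretchingDensity sfld) := continuous_stretchingDensity isSmooth_sfld
  have hmeas : Measurable (fun ξ : UnitAddTorus (Fin 3) =>
      torusVorticitySqAt sfld ξ ^ r * torusStretchingDensity sfld ξ) :=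
    (hQ.measurable.pow_const r).mul hσ.measurable
  refine Integrable.mono' hmi hmeas.aestronglyMeasurable (ae_of_all _ fun ξ => ?_)
  rw [Real.norm_eq_abs, moment_density_eq]
  exact (abs_moment_density_le hr1 hr0 (repr ξ)).1

/-! ## 4. A point of negative plateau density; negativity of the cube integral -/

/-- **A point where the plateau density is negative and continuous** (`r < 0`): the interior point of
part 4 (`(p, q) = √s⋆·(df s⋆, cf s⋆)`, `z = 1/4`, `ψf′(s⋆) = 16π`, `X1 = 2π`, `V = 1`), where both bases
are `≥ 4V² = 4 > 0`. [ours] -/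
theorem exists_Dplat_neg {r : ℝ} (hr : r < 0) :
    ∃ y : E3, (∀ i, y i ∈ Ioo (1 / 8 : ℝ) (7 / 8)) ∧ Dplat r y < 0 ∧ ContinuousAt (Dplat r) y := by
  obtain ⟨s, hs1, hs2, hψ⟩ := exists_deriv_ψf_pos
  have hs0 : 0 < s := by linarith
  set ρ := Real.sqrt s with hρ
  have hρ0 : 0 < ρ := Real.sqrt_pos.2 hs0
  have hρs : ρ ^ 2 = s := Real.sq_sqrt hs0.le
  have hρle : ρ < 5 / 16 := by
    rw [hρ, show (5 / 16 : ℝ) = Real.sqrt ((5 / 16) ^ 2) by rw [Real.sqrt_sq (by norm_num)]]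
    exact Real.sqrt_lt_sqrt hs0.le (by nlinarith)
  -- the point
  set y : E3 := WithLp.toLp 2 ![ρ * df s + 1 / 2, ρ * cf s + 1 / 2, 1 / 4] with hy
  have hy0 : y 0 = ρ * df s + 1 / 2 := by simp [hy]
  have hy1 : y 1 = ρ * cf s + 1 / 2 := by simp [hy]
  have hy2 : y 2 = 1 / 4 := by simp [hy]
  have hpc : pc y = ρ * df s := by simp only [pc, sh, hy0]; ring
  have hqc : qc y = ρ * cf s := by simp only [qc, sh, hy1]; ring
  have hcd := cf_sq_add_df_sq s
  have hrs : rs y = s := by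
    simp only [rs, hpc, hqc]; nlinarith [hρs, hcd]
  have hdf : |df s| ≤ 1 := Real.abs_sin_le_one _
  have hcf : |cf s| ≤ 1 := Real.abs_cos_le_one _
  refine ⟨y, ?_, ?_, ?_⟩
  · intro i
    fin_cases i
    · show y 0 ∈ Ioo (1 / 8 : ℝ) (7 / 8)
      rw [hy0]
      have : |ρ * df s| ≤ ρ * 1 := by rw [abs_mul, abs_of_pos hρ0]; exact mul_le_mul_of_nonneg_left hdf hρ0.le
      constructor <;> nlinarith [abs_le.1 this]
    · show y 1 ∈ Ioo (1 / 8 : ℝ) (7 / 8)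
      rw [hy1]
      have : |ρ * cf s| ≤ ρ * 1 := by rw [abs_mul, abs_of_pos hρ0]; exact mul_le_mul_of_nonneg_left hcf hρ0.le
      constructor <;> nlinarith [abs_le.1 this]
    · show y 2 ∈ Ioo (1 / 8 : ℝ) (7 / 8)
      rw [hy2]; constructor <;> norm_num
  · -- the value: `X1 = 2π`, bracket `< 0`, prefactor `8 · 1 · s · 16π > 0`
    obtain ⟨hB1, -, -, -⟩ := plateau_of_deriv_ψf_ne_zero (s := s) (by rw [hψ]; positivity)
    obtain ⟨hV, hdV⟩ := Vz_quarter
    have hkf : kf s = ρ⁻¹ := by simp [kf, hB1, hρ]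
    have hX1 : X1 y = 2 * π := by
      rw [X1_eq, hy2, hdV, hrs, hkf, hpc, hqc]
      have : ρ * df s * df s + ρ * cf s * cf s = ρ := by nlinarith [hcd]
      rw [this]; field_simp
    have hX1pos : 0 < X1 y := by rw [hX1]; positivity
    obtain ⟨-, hm⟩ := four_Vz_sq_le_bases y
    have hm0 : 0 < A0 y + X2 y - 2 * X1 y := by
      have : (0 : ℝ) < 4 * Vz (y 2) ^ 2 := by rw [hy2, hV]; norm_num
      linarith
    have hbr : bracket r y < 0 := by
      unfold bracket
      have hlt : A0 y + X2 y - 2 * X1 y < A0 y + X2 y + 2 * X1 y := by linarith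
      have h := Real.rpow_lt_rpow_of_neg hm0 hlt hr
      linarith
    have e : Dplat r y = bracket r y * (8 * Vz (y 2) * rs y * deriv ψf (rs y) * X1 y) := rfl
    rw [e, hy2, hV, hrs, hψ, hX1]
    have : 0 < 8 * (1 : ℝ) * s * (16 * π) * (2 * π) := by positivity
    exact mul_neg_of_neg_of_pos hbr this
  · -- continuity at the point: both bases are `> 0` there
    obtain ⟨hA, hX1c, hX2, -, -⟩ := continuous_densities
    have hrsc := contDiff_rs.continuous
    have hVc : Continuous fun y : E3 => Vz (y 2) :=
      continuous_Vz.comp ((EuclideanSpace.proj (2 : Fin 3) : E3 →L[ℝ] ℝ).continuous)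
    have hψ' : Continuous fun y => deriv ψf (rs y) := (contDiff_ψf.continuous_deriv (by simp)).comp hrsc
    obtain ⟨hp, hm⟩ := four_Vz_sq_le_bases y
    have h4 : (0 : ℝ) < 4 * Vz (y 2) ^ 2 := by rw [hy2, Vz_quarter.1]; norm_num
    have hc1 : Continuous fun y' => A0 y' + X2 y' + 2 * X1 y' := by fun_prop
    have hc2 : Continuous fun y' => A0 y' + X2 y' - 2 * X1 y' := by fun_prop
    have hbc : ContinuousAt (bracket r) y := by
      unfold bracket
      exact (hc1.continuousAt.rpow_const (Or.inl (lt_of_lt_of_le h4 hp).ne')).sub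
        (hc2.continuousAt.rpow_const (Or.inl (lt_of_lt_of_le h4 hm).ne'))
    unfold Dplat
    exact hbc.mul ((((continuous_const.mul hVc).mul hrsc).mul hψ').mul hX1c).continuousAt

/-- **`∫_{unit cube} Dplat < 0`** for `−1/2 ≤ r < 0`. [ours] -/
theorem setIntegral_Dplat_neg {r : ℝ} (hr1 : -1 / 2 ≤ r) (hr : r < 0) :
    ∫ y in unitCube (Fin 3), Dplat r y < 0 := by
  obtain ⟨y, hy, hneg, hc⟩ := exists_Dplat_neg hr
  set G : E3 → ℝ := fun z => -Dplat r z with hG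
  have hGc : ContinuousAt G y := hc.neg
  have hGpos : 0 < G y := by simp only [hG]; linarith
  have hGnn : ∀ z, 0 ≤ G z := fun z => by simp only [hG]; linarith [Dplat_nonpos hr.le z]
  have hGi : IntegrableOn G (unitCube (Fin 3)) volume := (integrableOn_Dplat_Gcoll hr1 hr.le).1.neg
  -- a ball on which `G ≥ G y / 2`
  obtain ⟨δ, hδ, hδP⟩ := Metric.continuousAt_iff.1 hGc (G y / 2) (by linarith)
  set δ' := min δ (1 / 8) with hδ'
  have hδ'0 : 0 < δ' := lt_min hδ (by norm_num)
  have hsub : ball y δ' ⊆ unitCube (Fin 3) :=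
    (ball_subset_ball (min_le_right _ _)).trans (ball_subset_unitCube hy)
  have hlow : ∀ z ∈ ball y δ', G y / 2 ≤ G z := by
    intro z hz
    have h := hδP (lt_of_lt_of_le (mem_ball.1 hz) (min_le_left _ _))
    rw [Real.dist_eq, abs_lt] at h
    linarith [h.1]
  have hball : volume.real (ball y δ') ≠ 0 := by
    rw [Measure.real, ENNReal.toReal_ne_zero]
    exact ⟨(measure_ball_pos (volume : Measure E3) y hδ'0).ne', measure_ball_lt_top.ne⟩
  have hballpos : 0 < volume.real (ball y δ') := lt_of_le_of_ne measureReal_nonneg (Ne.symm hball)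
  have hint : IntegrableOn G (ball y δ') volume := hGi.mono_set hsub
  have h1 : G y / 2 * volume.real (ball y δ') ≤ ∫ z in ball y δ', G z :=
    setIntegral_ge_of_const_le_real measurableSet_ball measure_ball_lt_top.ne hlow hint
  have h2 : ∫ z in ball y δ', G z ≤ ∫ z in unitCube (Fin 3), G z :=
    setIntegral_mono_set hGi (ae_of_all _ hGnn) (ae_of_all _ hsub)
  have h3 : 0 < G y / 2 * volume.real (ball y δ') := by positivity
  have hGint : ∫ z in unitCube (Fin 3), G z = -∫ z in unitCube (Fin 3), Dplat r z := by
    simp only [hG]; exact integral_neg _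
  linarith

/-! ## 5. `∫ (|ω|²)^r σ < 0` -/

/-- **The weighted stretching moment of the spiral-jet witness is NEGATIVE for every `r ∈ [−1/2, 0)`:**
`∫_{T³} (|ω|²)^r σ < 0`. [ours] -/
theorem integral_moment_neg {r : ℝ} (hr1 : -1 / 2 ≤ r) (hr : r < 0) :
    ∫ ξ : UnitAddTorus (Fin 3), torusVorticitySqAt sfld ξ ^ r * torusStretchingDensity sfld ξ < 0 := by
  set F : UnitAddTorus (Fin 3) → ℝ := fun ξ =>
    torusVorticitySqAt sfld ξ ^ r * torusStretchingDensity sfld ξ with hF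
  have hFi : Integrable F := integrable_moment_density hr1 hr.le
  have hFri : Integrable (fun ξ => F (reflT 2 ξ)) :=
    ((measurePreserving_reflT 2).integrable_comp_emb (reflTEquiv 2).measurableEmbedding).2 hFi
  obtain ⟨hDc, hGc⟩ := integrableOn_Dplat_Gcoll hr1 hr.le
  have hDi : Integrable (fun ξ : UnitAddTorus (Fin 3) => Dplat r (repr ξ)) := integrable_comp_repr hDc
  have hGi : Integrable (fun ξ : UnitAddTorus (Fin 3) => Gcoll r (repr ξ)) := integrable_comp_repr hGc
  -- (1) symmetrisation
  have hsym : ∫ ξ, F ξ = ∫ ξ, F (reflT 2 ξ) := (integral_comp_reflT 2 F).symm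
  have hsum : ∀ ξ, F ξ + F (reflT 2 ξ) = Gcoll r (repr ξ) + Dplat r (repr ξ) := by
    intro ξ
    simp only [hF]
    rw [moment_density_eq, moment_density_reflT_two, symmetrised_eq]
  have h2 : 2 * ∫ ξ, F ξ = (∫ ξ, Gcoll r (repr ξ)) + ∫ ξ, Dplat r (repr ξ) := by
    rw [two_mul]
    nth_rewrite 2 [hsym]
    rw [← integral_add hFi hFri, ← integral_add hGi hDi]
    exact integral_congr_ae (ae_of_all _ hsum)
  -- (2) the collar part integrates to zero by the `x`-reflection
  have hcoll : ∫ ξ, Gcoll r (repr ξ) = 0 := by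
    have hodd : ∀ ξ, Gcoll r (repr (reflT 0 ξ)) = -Gcoll r (repr ξ) := fun ξ => by
      unfold Gcoll bracket
      exact Gcoll_reflT_zero r ξ
    have h := integral_comp_reflT 0 (fun ξ => Gcoll r (repr ξ))
    simp only [hodd, integral_neg] at h
    linarith
  -- (3) the plateau part is negative
  have hplat : ∫ ξ, Dplat r (repr ξ) < 0 := by
    rw [integral_comp_repr (Dplat r)]
    exact setIntegral_Dplat_neg hr1 hr
  have : 2 * ∫ ξ, F ξ < 0 := by rw [h2, hcoll, zero_add]; exact hplat
  linarith

end SpiralJet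

end Summit.NavierStokesRegularity.FunctionalMining

end
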